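import Summits.AtomisticToContinuum.Crystallization.Theses.PricedLinkCensus
import Literature.MathematicalPhysics.StatisticalMechanics.LennardJonesClusters

/-!
# `ChargedEnergyGap` (stmt-AtomisticToContinuum-14231), negative side I: far translated copies

Structural lemmas for the crux `PricedLinkCensus.ChargedEnergyGap` (refuter, cdisprove seat,
generation 2): the parametrised inequality `GapWith η κ C`, small configurations are fully charged,
and the far-copies construction (`copiesFin`: energy `≤ M·E(y)`, bond graph = disjoint union,
`#charged` multiplied by `M`) used by the no-boundary reduction (part II).  All `[folklore]`.
-/

noncomputable section

namespace Summit.AtomisticToContinuum.Crystallization.Theorems.ChargedEnergyGapNegative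

open Literature.MathematicalPhysics.StatisticalMechanics
open Literature.Geometry.DiscreteGeometry
open Summit.AtomisticToContinuum.Crystallization.Theses.PricedLinkCensus
open scoped BigOperators

/-! ## §0. The crux, parametrised -/

/-- Ambient space `ℝ³`. [folklore] -/
abbrev E3 : Type := EuclideanSpace ℝ (Fin 3)

/-- `e* = ⨅_Q e_LJ(Q)`, the infimum of the Lennard-Jones energy per particle over periodic
configurations of `ℝ³` (a conditionally complete infimum: the junk value `0` if the range is not
bounded below — item 0714 `CrysPeriodicBddBelow`). [folklore] -/
def eStar : ℝ := ⨅ Q : PeriodicConfiguration 3, Q.energyPerParticle lennardJones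

/-- The number of charged (= not charge-free at tolerance `η`) sites of a finite configuration. [folklore] -/
def charged (η : ℝ) {N : ℕ} (y : Fin N → E3) : ℕ := Nat.card {i : Fin N // ¬ IsChargeFree η y i}

/-- The crux inequality with parameters: tolerance `η`, price `κ`, boundary allowance `C`. [folklore] -/
def GapWith (η κ C : ℝ) : Prop :=
  ∀ (N : ℕ) (y : Fin N → E3), Function.Injective y →
    (N : ℝ) * eStar + κ * (charged η y : ℝ) - C * (N : ℝ) ^ (2 / 3 : ℝ) ≤
      interactionEnergy lennardJones y

/-- The same inequality WITHOUT boundary allowance (`C = 0`). [folklore] -/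
def NoBoundary (η κ : ℝ) : Prop :=
  ∀ (N : ℕ) (y : Fin N → E3), Function.Injective y →
    (N : ℝ) * eStar + κ * (charged η y : ℝ) ≤ interactionEnergy lennardJones y

/-- The crux is `∃ κ > 0, ∃ C, GapWith (1/100) κ C`, by `Iff.rfl`. [folklore] -/
theorem chargedEnergyGap_iff : ChargedEnergyGap ↔ ∃ κ C : ℝ, 0 < κ ∧ GapWith (1 / 100) κ C :=
  Iff.rfl

/-! ## §1. Small configurations: with at most twelve sites every site is charged -/

/-- A site whose index type has at most `12` elements is never charge-free: its neighbour set
misses the site itself, so it has at most `11` elements. [folklore] -/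
theorem not_isChargeFree_of_card_le {ι X : Type*} [PseudoMetricSpace X] [Finite ι]
    (h : Nat.card ι ≤ 12) (η : ℝ) (y : ι → X) (i : ι) : ¬ IsChargeFree η y i := by
  intro hcf
  have hsub : (bondGraph η y).neighborSet i ⊆ {k | k ≠ i} := by
    intro k hk
    exact ((bondGraph η y).ne_of_adj hk).symm
  have hlt : ({k | k ≠ i} : Set ι).ncard < Nat.card ι := by
    have : ({k | k ≠ i} : Set ι) = {i}ᶜ := by ext k; simp
    rw [this, Set.ncard_compl, Set.ncard_singleton]
    have : 0 < Nat.card ι := Nat.card_pos_iff.2 ⟨⟨i⟩, inferInstance⟩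
    omega
  have h12 := hcf.1
  have := Set.ncard_le_ncard hsub (Set.toFinite _)
  omega

/-- Hence a configuration of `N ≤ 12` points has exactly `N` charged sites. [folklore] -/
theorem charged_eq_of_le {η : ℝ} {N : ℕ} (hN : N ≤ 12) (y : Fin N → E3) : charged η y = N := by
  unfold charged
  have h : ∀ i : Fin N, ¬ IsChargeFree η y i := fun i =>
    not_isChargeFree_of_card_le (by simpa using hN) η y i
  rw [Nat.card_congr (Equiv.subtypeUnivEquiv h), Nat.card_eq_fintype_card, Fintype.card_fin]

/-- The empty configuration has no charged site. [folklore] -/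
theorem charged_zero {η : ℝ} (y : Fin 0 → E3) : charged η y = 0 := charged_eq_of_le (by norm_num) y


/-! ## §2. Far translated copies: the boundary allowance `C·N^(2/3)` is not load-bearing -/

section Copies

variable {N : ℕ}

/-- The first coordinate unit vector `e₀`. [folklore] -/
def e0 : E3 := EuclideanSpace.single 0 1

/-- `‖e₀‖ = 1`. [folklore] -/
@[simp] theorem norm_e0 : ‖e0‖ = 1 := by
  simp [e0]

/-- A size parameter: `D(y) = Σᵢ ‖yᵢ‖`, so that `‖yᵢ‖ ≤ D` and all mutual distances are `≤ 2D`. [folklore] -/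
def Dsum (y : Fin N → E3) : ℝ := ∑ i, ‖y i‖

/-- `0 ≤ D(y)`. [folklore] -/
theorem Dsum_nonneg (y : Fin N → E3) : 0 ≤ Dsum y :=
  Finset.sum_nonneg fun _ _ => norm_nonneg _

/-- `‖yᵢ‖ ≤ D(y)`. [folklore] -/
theorem norm_le_Dsum (y : Fin N → E3) (i : Fin N) : ‖y i‖ ≤ Dsum y :=
  Finset.single_le_sum (f := fun i => ‖y i‖) (fun _ _ => norm_nonneg _) (Finset.mem_univ i)

/-- All mutual distances are at most `2D(y)`. [folklore] -/
theorem dist_le_two_Dsum (y : Fin N → E3) (i j : Fin N) : dist (y i) (y j) ≤ 2 * Dsum y := by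
  rw [dist_eq_norm]
  linarith [norm_sub_le (y i) (y j), norm_le_Dsum y i, norm_le_Dsum y j]

/-- Nearest-neighbour distances are at most `2D(y)` (when there is another site). [folklore] -/
theorem nearestDist_le_two_Dsum (y : Fin N → E3) {i j : Fin N} (h : j ≠ i) :
    nearestDist y i ≤ 2 * Dsum y :=
  (nearestDist_le_dist y h).trans (dist_le_two_Dsum y i j)

/-- `M` translated copies of `y` at spacing `L` along `e₀`, indexed by `Fin M × Fin N`. [folklore] -/
def copies (M : ℕ) (L : ℝ) (y : Fin N → E3) : Fin M × Fin N → E3 :=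
  fun p => y p.2 + (((p.1 : ℕ) : ℝ) * L) • e0

/-- The same configuration re-indexed by `Fin (M * N)`. [folklore] -/
def copiesFin (M : ℕ) (L : ℝ) (y : Fin N → E3) : Fin (M * N) → E3 :=
  copies M L y ∘ finProdFinEquiv.symm

/-- Unfolding `copiesFin`. [folklore] -/
theorem copiesFin_apply (M : ℕ) (L : ℝ) (y : Fin N → E3) (a : Fin (M * N)) :
    copiesFin M L y a = copies M L y (finProdFinEquiv.symm a) := rfl

/-- Distances inside one copy are those of `y`. [folklore] -/
theorem dist_copies_same (M : ℕ) (L : ℝ) (y : Fin N → E3) (c : Fin M) (i j : Fin N) :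
    dist (copies M L y (c, i)) (copies M L y (c, j)) = dist (y i) (y j) := by
  simp [copies, dist_add_right]

/-- Distances between different copies are at least `L − 2D` (for `L ≥ 0`). [folklore] -/
theorem le_dist_copies_ne (M : ℕ) {L : ℝ} (hL : 0 ≤ L) (y : Fin N → E3) {p q : Fin M × Fin N}
    (h : p.1 ≠ q.1) : L - 2 * Dsum y ≤ dist (copies M L y p) (copies M L y q) := by
  have hcc : (1 : ℝ) ≤ |((p.1 : ℕ) : ℝ) - ((q.1 : ℕ) : ℝ)| := by
    have : (p.1 : ℕ) ≠ (q.1 : ℕ) := fun h' => h (Fin.ext h')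
    rcases lt_or_gt_of_ne this with hlt | hlt
    · have : ((p.1 : ℕ) : ℝ) + 1 ≤ ((q.1 : ℕ) : ℝ) := by exact_mod_cast hlt
      rw [abs_of_neg (by linarith)]
      linarith
    · have : ((q.1 : ℕ) : ℝ) + 1 ≤ ((p.1 : ℕ) : ℝ) := by exact_mod_cast hlt
      rw [abs_of_pos (by linarith)]
      linarith
  have hv : ‖((((p.1 : ℕ) : ℝ) * L) • e0 - (((q.1 : ℕ) : ℝ) * L) • e0 : E3)‖ =
      |((p.1 : ℕ) : ℝ) - ((q.1 : ℕ) : ℝ)| * L := by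
    rw [← sub_smul, norm_smul, norm_e0, mul_one, ← sub_mul, Real.norm_eq_abs, abs_mul,
      abs_of_nonneg hL]
  have hL' : L ≤ |((p.1 : ℕ) : ℝ) - ((q.1 : ℕ) : ℝ)| * L := by nlinarith
  have key : ‖((((p.1 : ℕ) : ℝ) * L) • e0 - (((q.1 : ℕ) : ℝ) * L) • e0 : E3)‖ - ‖y q.2 - y p.2‖ ≤
      dist (copies M L y p) (copies M L y q) := by
    rw [dist_eq_norm]
    have e : copies M L y p - copies M L y q =
        ((((p.1 : ℕ) : ℝ) * L) • e0 - (((q.1 : ℕ) : ℝ) * L) • e0) - (y q.2 - y p.2) := by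
      simp only [copies]; abel
    rw [e]
    exact norm_sub_norm_le _ _
  have hd : ‖y q.2 - y p.2‖ ≤ 2 * Dsum y := by
    rw [← dist_eq_norm]; exact dist_le_two_Dsum y q.2 p.2
  linarith

/-- The copies of an injective configuration form an injective configuration (`L > 2D`). [folklore] -/
theorem copies_injective (M : ℕ) {L : ℝ} {y : Fin N → E3} (hL : 2 * Dsum y < L)
    (hy : Function.Injective y) : Function.Injective (copies M L y) := by
  intro p q hpq
  by_cases h : p.1 = q.1
  · have h2 : y p.2 = y q.2 := by
      have := congrArg (fun v => v - (((p.1 : ℕ) : ℝ) * L) • e0) hpq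
      simpa [copies, h] using this
    exact Prod.ext h (hy h2)
  · have hL0 : 0 ≤ L := by linarith [Dsum_nonneg y]
    have := le_dist_copies_ne M hL0 y h
    rw [hpq, dist_self] at this
    linarith

/-- `copiesFin` of an injective configuration is injective (`L > 2D`). [folklore] -/
theorem copiesFin_injective (M : ℕ) {L : ℝ} {y : Fin N → E3} (hL : 2 * Dsum y < L)
    (hy : Function.Injective y) : Function.Injective (copiesFin M L y) :=
  (copies_injective M hL hy).comp finProdFinEquiv.symm.injective

/-- **Energy of far copies.** If the copies are at mutual distances `≥ 1` (i.e. `L − 2D ≥ 1`),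
where `V_LJ ≤ 0`, the energy of `M` copies is at most `M` times the energy of `y`. [folklore] -/
theorem interactionEnergy_copiesFin_le (M : ℕ) {L : ℝ} (y : Fin N → E3)
    (hL : 1 ≤ L - 2 * Dsum y) :
    interactionEnergy lennardJones (copiesFin M L y) ≤
      (M : ℝ) * interactionEnergy lennardJones y := by
  have hL0 : 0 ≤ L := by linarith [Dsum_nonneg y]
  have h2 := two_mul_interactionEnergy_eq_sum_sum lennardJones lennardJones_zero (copiesFin M L y)
  have h2y := two_mul_interactionEnergy_eq_sum_sum lennardJones lennardJones_zero y
  -- re-index the double sum by `Fin M × Fin N`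
  have hre : ∑ a, ∑ b, lennardJones (dist (copiesFin M L y a) (copiesFin M L y b)) =
      ∑ p : Fin M × Fin N, ∑ q : Fin M × Fin N,
        lennardJones (dist (copies M L y p) (copies M L y q)) := by
    simp only [copiesFin_apply]
    exact (finProdFinEquiv.symm.sum_comp (fun p => ∑ b : Fin (M * N),
      lennardJones (dist (copies M L y p) (copies M L y (finProdFinEquiv.symm b))))).trans
      (Finset.sum_congr rfl fun p _ => finProdFinEquiv.symm.sum_comp
        (fun q => lennardJones (dist (copies M L y p) (copies M L y q))))
  -- bound each row: the own copy gives the `y`-row, the other copies contribute `≤ 0`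
  have hrow : ∀ (c : Fin M) (i : Fin N),
      ∑ q : Fin M × Fin N, lennardJones (dist (copies M L y (c, i)) (copies M L y q)) ≤
        ∑ j, lennardJones (dist (y i) (y j)) := by
    intro c i
    rw [Fintype.sum_prod_type, ← Finset.add_sum_erase _ _ (Finset.mem_univ c)]
    have hown : ∑ j : Fin N, lennardJones (dist (copies M L y (c, i)) (copies M L y (c, j))) =
        ∑ j, lennardJones (dist (y i) (y j)) := by
      simp only [dist_copies_same]
    have hrest : ∑ c' ∈ Finset.univ.erase c, ∑ j : Fin N,
        lennardJones (dist (copies M L y (c, i)) (copies M L y (c', j))) ≤ 0 := by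
      refine Finset.sum_nonpos fun c' hc' => Finset.sum_nonpos fun j _ => ?_
      have hne : ((c, i) : Fin M × Fin N).1 ≠ ((c', j) : Fin M × Fin N).1 :=
        fun h => (Finset.ne_of_mem_erase hc') h.symm
      exact lennardJones_nonpos (hL.trans (le_dist_copies_ne M hL0 y hne))
    linarith
  have hsum : ∑ p : Fin M × Fin N, ∑ q : Fin M × Fin N,
        lennardJones (dist (copies M L y p) (copies M L y q)) ≤
      (M : ℝ) * ∑ i, ∑ j, lennardJones (dist (y i) (y j)) := by
    rw [Fintype.sum_prod_type]
    calc ∑ c : Fin M, ∑ i : Fin N, ∑ q : Fin M × Fin N,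
          lennardJones (dist (copies M L y (c, i)) (copies M L y q))
        ≤ ∑ _c : Fin M, ∑ i : Fin N, ∑ j, lennardJones (dist (y i) (y j)) :=
          Finset.sum_le_sum fun c _ => Finset.sum_le_sum fun i _ => hrow c i
      _ = (M : ℝ) * ∑ i, ∑ j, lennardJones (dist (y i) (y j)) := by
          rw [Finset.sum_const, Finset.card_univ, Fintype.card_fin, nsmul_eq_mul]
  have hfin : 2 * interactionEnergy lennardJones (copiesFin M L y) ≤
      (M : ℝ) * (2 * interactionEnergy lennardJones y) := by
    rw [h2, h2y, hre]; exact hsum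
  linarith

/-- A convenient spacing: `L(y) = 8·D(y) + 8`. Then `L − 2D = 6D + 8` exceeds `1`, `2D` and
`2·(2D)` (twice the largest possible nearest-neighbour distance). [folklore] -/
def spacing (y : Fin N → E3) : ℝ := 8 * Dsum y + 8

/-- `0 ≤ L(y)`. [folklore] -/
theorem spacing_nonneg (y : Fin N → E3) : 0 ≤ spacing y := by
  unfold spacing; linarith [Dsum_nonneg y]

/-- `1 ≤ L(y) − 2D(y)`. [folklore] -/
theorem one_le_spacing_sub (y : Fin N → E3) : 1 ≤ spacing y - 2 * Dsum y := by
  unfold spacing; linarith [Dsum_nonneg y]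

/-- `2D(y) < L(y)`. [folklore] -/
theorem two_Dsum_lt_spacing (y : Fin N → E3) : 2 * Dsum y < spacing y := by
  unfold spacing; linarith [Dsum_nonneg y]

/-- Cross-copy distances at the spacing `L(y)`: at least `6D + 8`. [folklore] -/
theorem le_dist_copies_ne_spacing (M : ℕ) (y : Fin N → E3) {p q : Fin M × Fin N}
    (h : p.1 ≠ q.1) : 6 * Dsum y + 8 ≤ dist (copies M (spacing y) y p) (copies M (spacing y) y q) := by
  have h' : spacing y - 2 * Dsum y = 6 * Dsum y + 8 := by unfold spacing; ring
  rw [← h']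
  exact le_dist_copies_ne M (spacing_nonneg y) y h

/-- **Nearest-neighbour distances are unchanged in the copies** (for `N ≥ 2`, i.e. when site `i`
has another site `j ≠ i`). [folklore] -/
theorem nearestDist_copies (M : ℕ) (y : Fin N → E3) (c : Fin M) {i : Fin N} (hi : ∃ j, j ≠ i) :
    nearestDist (copies M (spacing y) y) (c, i) = nearestDist y i := by
  obtain ⟨j₀, hj₀, hnn⟩ := exists_nearestDist_eq_dist y hi
  apply le_antisymm
  · have hne : ((c, j₀) : Fin M × Fin N) ≠ (c, i) := fun h => hj₀ (Prod.ext_iff.1 h).2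
    calc nearestDist (copies M (spacing y) y) (c, i)
        ≤ dist (copies M (spacing y) y (c, i)) (copies M (spacing y) y (c, j₀)) :=
          nearestDist_le_dist _ hne
      _ = nearestDist y i := by rw [dist_copies_same, hnn]
  · refine le_nearestDist ⟨(c, j₀), fun h => hj₀ (Prod.ext_iff.1 h).2⟩ fun q hq => ?_
    by_cases hc : q.1 = c
    · have hq2 : q.2 ≠ i := fun h => hq (Prod.ext hc h)
      obtain ⟨c', j⟩ := q
      simp only at hc
      subst hc
      rw [dist_copies_same]
      exact nearestDist_le_dist y hq2
    · have hne : ((c, i) : Fin M × Fin N).1 ≠ q.1 := fun h => hc h.symm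
      calc nearestDist y i ≤ 2 * Dsum y := nearestDist_le_two_Dsum y hj₀
        _ ≤ 6 * Dsum y + 8 := by linarith [Dsum_nonneg y]
        _ ≤ _ := le_dist_copies_ne_spacing M y hne

/-- **The bond graph of the copies is the disjoint union of the bond graphs** (tolerance
`0 ≤ η ≤ 1`, `N ≥ 2`): two sites are bonded iff they lie in the same copy and are bonded in `y`. [folklore] -/
theorem bondGraph_copies_adj (M : ℕ) {η : ℝ} (hη1 : η ≤ 1) (y : Fin N → E3)
    (hN : ∀ i : Fin N, ∃ j, j ≠ i) (p q : Fin M × Fin N) :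
    (bondGraph η (copies M (spacing y) y)).Adj p q ↔ p.1 = q.1 ∧ (bondGraph η y).Adj p.2 q.2 := by
  rw [bondGraph_adj, bondGraph_adj]
  obtain ⟨c, i⟩ := p
  obtain ⟨c', j⟩ := q
  simp only [nearestDist_copies M y _ (hN _)]
  constructor
  · rintro ⟨hne, hle⟩
    by_cases hc : c = c'
    · subst hc
      refine ⟨rfl, fun h => hne (by rw [h]), ?_⟩
      rwa [dist_copies_same] at hle
    · exfalso
      have hfar := le_dist_copies_ne_spacing M y (p := (c, i)) (q := (c', j)) hc
      obtain ⟨j₀, hj₀⟩ := hN i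
      have hnn : nearestDist y i ≤ 2 * Dsum y := nearestDist_le_two_Dsum y hj₀
      have hmin : min (nearestDist y i) (nearestDist y j) ≤ 2 * Dsum y :=
        (min_le_left _ _).trans hnn
      have h1 : (1 + η) * min (nearestDist y i) (nearestDist y j) ≤ 2 * (2 * Dsum y) :=
        mul_le_mul (by linarith) hmin (le_min (nearestDist_nonneg _ _) (nearestDist_nonneg _ _))
          (by norm_num)
      linarith [Dsum_nonneg y]
  · rintro ⟨hc, hne, hle⟩
    subst hc
    refine ⟨fun h => hne (Prod.ext_iff.1 h).2, ?_⟩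
    rwa [dist_copies_same]

/-- Neighbour sets in the copies are the images of the neighbour sets of `y`. [folklore] -/
theorem neighborSet_copies (M : ℕ) {η : ℝ} (hη1 : η ≤ 1) (y : Fin N → E3)
    (hN : ∀ i : Fin N, ∃ j, j ≠ i) (c : Fin M) (i : Fin N) :
    (bondGraph η (copies M (spacing y) y)).neighborSet (c, i) =
      Prod.mk c '' (bondGraph η y).neighborSet i := by
  ext ⟨c', j⟩
  rw [SimpleGraph.mem_neighborSet, bondGraph_copies_adj M hη1 y hN, Set.mem_image]
  constructor
  · rintro ⟨hc, hadj⟩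
    simp only at hc
    exact ⟨j, hadj, by rw [hc]⟩
  · rintro ⟨j', hj', h⟩
    obtain ⟨rfl, rfl⟩ := Prod.ext_iff.1 h
    exact ⟨rfl, hj'⟩

/-- `Prod.mk c` is injective. [folklore] -/
theorem prodMk_injective' {α β : Type*} (c : α) : Function.Injective (Prod.mk c : β → α × β) :=
  fun _ _ h => (Prod.ext_iff.1 h).2

/-- Ring numbers along bonds are unchanged in the copies. [folklore] -/
theorem ringNumber_copies (M : ℕ) {η : ℝ} (hη1 : η ≤ 1) (y : Fin N → E3)
    (hN : ∀ i : Fin N, ∃ j, j ≠ i) (c : Fin M) (i j : Fin N) :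
    ringNumber η (copies M (spacing y) y) (c, i) (c, j) = ringNumber η y i j := by
  rw [ringNumber_def, ringNumber_def, neighborSet_copies M hη1 y hN,
    neighborSet_copies M hη1 y hN, ← Set.image_inter (prodMk_injective' c),
    Set.ncard_image_of_injective _ (prodMk_injective' c)]

/-- **Charge-freeness is unchanged in the copies.** [folklore] -/
theorem isChargeFree_copies_iff (M : ℕ) {η : ℝ} (hη1 : η ≤ 1) (y : Fin N → E3)
    (hN : ∀ i : Fin N, ∃ j, j ≠ i) (c : Fin M) (i : Fin N) :
    IsChargeFree η (copies M (spacing y) y) (c, i) ↔ IsChargeFree η y i := by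
  rw [isChargeFree_iff, isChargeFree_iff, neighborSet_copies M hη1 y hN,
    Set.ncard_image_of_injective _ (prodMk_injective' c), Set.forall_mem_image]
  refine and_congr_right fun _ => forall₂_congr fun j _ => ?_
  rw [ringNumber_copies M hη1 y hN]

/-- **The copies carry `M` times as many charged sites.** [folklore] -/
theorem charged_copiesFin (M : ℕ) {η : ℝ} (hη1 : η ≤ 1) (y : Fin N → E3)
    (hN : ∀ i : Fin N, ∃ j, j ≠ i) :
    charged η (copiesFin M (spacing y) y) = M * charged η y := by
  unfold charged
  have e1 : {a : Fin (M * N) // ¬ IsChargeFree η (copiesFin M (spacing y) y) a} ≃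
      {p : Fin M × Fin N // ¬ IsChargeFree η y p.2} := by
    refine (finProdFinEquiv.symm.subtypeEquiv fun a => ?_)
    rw [copiesFin, isChargeFree_comp_equiv_iff, isChargeFree_copies_iff M hη1 y hN]
  have e2 : {p : Fin M × Fin N // ¬ IsChargeFree η y p.2} ≃
      Fin M × {i : Fin N // ¬ IsChargeFree η y i} :=
    { toFun := fun p => (p.1.1, ⟨p.1.2, p.2⟩)
      invFun := fun q => ⟨(q.1, q.2.1), q.2.2⟩
      left_inv := fun p => rfl
      right_inv := fun q => rfl }
  rw [Nat.card_congr (e1.trans e2), Nat.card_prod, Nat.card_eq_fintype_card, Fintype.card_fin]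

end Copies

end Summit.AtomisticToContinuum.Crystallization.Theorems.ChargedEnergyGapNegative

end
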